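/-
Copyright: the b2b-balaban cell (near-miss cell 7), T⁴-continuum fan-out; row NE7b ROUND-2 swarm, seat
t4-ne7b-formalise-leaf-10 (gen 3; rows S6g′(f) + S1c of `t4/b2b-balaban-t4-ne7b-p1/LEAVES-NE7b.md`, owner's rulings
R-OWNER-22-18∕19∕20).  Released under the licence of the surrounding project.
-/
import Summits.QuantumFields.BalabanUV.T4Continuum.Support.HistorySiblingEntropySortTwin

/-!
# The sorted twin keeps the class data: birth mass, partner ages, merger and renewal counts, ancestries, forest
# (rows S6g′(f) × S1c, file 1′ continued)

Summits-side support leaf of the T⁴-continuum cell (rung (B)+1 on a FINITE torus only; NOT infinite volume, NOT the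
mass gap, NOT the Clay statement; NOT a proof of the spine estimate NE7b).  Sequel of `HistorySiblingEntropySortTwin`.
[folklore] well-founded recursion over the pedigree's steps; nothing quoted from print, nothing printed asserted, no
`[cite:]` tag, no `Prop` fact minted.

WHY.  The zone-form count counts the sorted twin's flat genealogy `P.sortR.gen c` while the weights (and the booked
cost) are read on the realised pedigree `P`; the class key must therefore be the SAME on both: this file shows that the
budget letters of the entropy END and of the count — `bsum w`, `partnerAges`, `HistoryJoinsBudget.mrg`, `NR` — and
the root step take the same values on `P.sortR.gen c` and `P.gen c`, and that the twin is again a `Forest` with the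
same ancestries `names`.  Each quantity is a symmetric function of a cluster's parts (`bsum_chainMerge`, `NR_chain`,
`mrg_chain`, `HistoryJoins.partnerAges_add_eq_sum_clusterParts`), so permuting the tails changes nothing.

WHAT.  `bsum_chainMerge`, `NR_chain`, `mrg_chain`, `partnerAges_chain`; `rootStep_gen_sortR`, **`bsum_gen_sortR`**,
**`NR_gen_sortR`**, **`mrg_gen_sortR`**, **`partnerAges_gen_sortR`**; `names_sortR`, **`forest_sortR`**; and the END
restated with `P`'s letters on the right: **`ENT_sortR_le`**:
`ENT (P.sortR.gen c) ≤ 2·bsum (1 + fat) (P.gen c) + 4·partnerAges (P.gen c) + 8·mrg (P.gen c) + 8·NR (P.gen c)`.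

HONEST SCOPE.  Bookkeeping identities over OUR carriers.  NE7b NOT proved.  HONEST DEPENDENCY (cell): continuum YM on
T⁴ ⇐ BetaPertH ∧ nine spine estimates (0/9 proved); BetaPertH ⇐ (D1) ∧ (D4) ∧ CAP+tail; G-an2-4 gates asym, D1 and
NE2/3/4.  This file changes none of it.
-/

open Finset
open Literature.MathematicalPhysics.QuantumFieldTheory.Balaban1983to89
open T4PersistenceDictionary T4PartnerMultiplicity T4BranchingRecordsGas
open Summit.QuantumFields.BalabanUV.T4Continuum.ZoneSkeleton
open Summit.QuantumFields.BalabanUV.T4Continuum.HistorySiblingEntropyBound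
open Summit.QuantumFields.BalabanUV.T4Continuum.HistoryGen
open Summit.QuantumFields.BalabanUV.T4Continuum.HistoryJoins
open Summit.QuantumFields.BalabanUV.T4Continuum.HistoryJoinsAdm
open Summit.QuantumFields.BalabanUV.T4Continuum.HistoryJoinsBudget (mrg)
open Summit.QuantumFields.BalabanUV.T4Continuum.HistoryJoinsEntropyBudget (ENT)

noncomputable section

open scoped Classical

namespace Summit.QuantumFields.BalabanUV.T4Continuum.HistorySiblingEntropyBridge

/-! ## §1 The budget letters of a chain are symmetric in the parts -/

section Chain

variable {ε : Type*} (st : ε → ℕ)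

/-- birth mass of a chain [folklore] -/
theorem bsum_chainMerge (w : ε → ℝ) : ∀ (G : Gen ε) (Hs : List (Gen ε)) (t : ℕ → ε),
    bsum w (chainMerge G Hs t) = bsum w G + (Hs.map (bsum w)).sum
  | G, [], _ => by simp
  | G, H :: Hs, t => by rw [chainMerge_cons, bsum_chainMerge w _ Hs _]; simp [bsum]; ring

/-- the parts of a chain of closed members, as the indexed sum's list [folklore] -/
theorem sum_part_chain {s : ℕ} {l : ε} (hl : st l = s) {q₀ : Gen ε} {qs : List (Gen ε)} {X Y : Gen ε}
    (hG : chainMerge q₀ qs (fun _ => l) = Gen.merge X Y l) (h₀ : clusterParts st s q₀ = [([], q₀)])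
    (hqs : ∀ q ∈ qs, clusterParts st s q = [([], q)]) {M : Type*} [AddCommMonoid M] (g : Gen ε → M) :
    ∑ i, g (part st (Gen.merge X Y l) i).2 = ((q₀ :: qs).map g).sum := by
  rw [sum_parts_eq st _ (fun q => g q.2)]
  have hsnd : (jparts st (Gen.merge X Y l)).map Prod.snd = q₀ :: qs := by
    simp only [jparts]
    rw [hl, ← hG, snd_clusterParts_chainMerge st s l hl q₀ qs hqs, h₀]
    simp
  rw [← hsnd, List.map_map]
  rfl

/-- the number of parts of a chain of closed members [folklore] -/
theorem npart_chain {s : ℕ} {l : ε} (hl : st l = s) {q₀ : Gen ε} {qs : List (Gen ε)} {X Y : Gen ε}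
    (hG : chainMerge q₀ qs (fun _ => l) = Gen.merge X Y l) (h₀ : clusterParts st s q₀ = [([], q₀)])
    (hqs : ∀ q ∈ qs, clusterParts st s q = [([], q)]) : npart st (Gen.merge X Y l) = qs.length + 1 := by
  have hsnd : (jparts st (Gen.merge X Y l)).map Prod.snd = q₀ :: qs := by
    simp only [jparts]
    rw [hl, ← hG, snd_clusterParts_chainMerge st s l hl q₀ qs hqs, h₀]
    simp
  have := congrArg List.length hsnd
  simp only [List.length_map, List.length_cons] at this
  simpa [npart] using this

/-- renewal count of a chain of closed members [folklore] -/
theorem NR_chain {s : ℕ} {l : ε} (hl : st l = s) (q₀ : Gen ε) (qs : List (Gen ε))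
    (h₀ : clusterParts st s q₀ = [([], q₀)]) (hqs : ∀ q ∈ qs, clusterParts st s q = [([], q)]) :
    NR st (chainMerge q₀ qs fun _ => l) = ((q₀ :: qs).map (NR st)).sum := by
  by_cases hne : qs = []
  · subst hne; simp
  · obtain ⟨X, Y, hXY⟩ := exists_chainMerge_eq_merge l q₀ qs hne
    rw [hXY, NR, sum_part_chain st hl hXY h₀ hqs]

/-- merger count of a chain of closed members [folklore] -/
theorem mrg_chain {s : ℕ} {l : ε} (hl : st l = s) (q₀ : Gen ε) (qs : List (Gen ε))
    (h₀ : clusterParts st s q₀ = [([], q₀)]) (hqs : ∀ q ∈ qs, clusterParts st s q = [([], q)]) :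
    mrg st (chainMerge q₀ qs fun _ => l) = (qs.length : ℝ) + ((q₀ :: qs).map (mrg st)).sum := by
  by_cases hne : qs = []
  · subst hne; simp
  · obtain ⟨X, Y, hXY⟩ := exists_chainMerge_eq_merge l q₀ qs hne
    rw [hXY, mrg, sum_part_chain st hl hXY h₀ hqs, npart_chain st hl hXY h₀ hqs]
    push_cast
    ring

/-- partner ages of a chain of closed members (with the root-step correction) [folklore] -/
theorem partnerAges_chain {s : ℕ} {l : ε} (hl : st l = s) (q₀ : Gen ε) (qs : List (Gen ε))
    (h₀ : clusterParts st s q₀ = [([], q₀)]) (hqs : ∀ q ∈ qs, clusterParts st s q = [([], q)]) :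
    partnerAges st (chainMerge q₀ qs fun _ => l) + (s + 1 - (chainMerge q₀ qs fun _ => l).rootStep) =
      ((q₀ :: qs).map fun q => partnerAges st q + (s + 1 - q.rootStep)).sum := by
  rw [partnerAges_add_eq_sum_clusterParts st s]
  by_cases hne : qs = []
  · subst hne; simp [h₀]
  · obtain ⟨X, Y, hXY⟩ := exists_chainMerge_eq_merge l q₀ qs hne
    have hsnd : (clusterParts st s (chainMerge q₀ qs fun _ => l)).map Prod.snd = q₀ :: qs := by
      rw [snd_clusterParts_chainMerge st s l hl q₀ qs hqs, h₀]; simp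
    rw [show (fun q : List Bool × Gen ε => partnerAges st q.2 + (s + 1 - q.2.rootStep)) =
        (fun q : Gen ε => partnerAges st q + (s + 1 - q.rootStep)) ∘ Prod.snd from rfl, ← List.map_map, hsnd]

end Chain

/-! ## §2 The sorted twin keeps the letters -/

variable {α π : Type*} (P : Pedigree α π)

/-- root steps are unchanged [folklore] -/
theorem rootStep_gen_sortR (hH : ∀ c, P.HeadOldest c) (c : α) : (P.sortR.gen c).rootStep = (P.gen c).rootStep :=
  rootStep_eq_of_toShapeR_eq (toShapeR_gen_sortR P hH c)

/-- the generic transfer: a letter `Φ` that is determined on births, follows renewals, and on a chain of closed members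
is a function of the step, the chain's root step and the MULTISET of the parts' letters, is unchanged by sorting the
tails [folklore] -/
theorem letter_gen_sortR {M : Type*} (Φ : Gen PEv → M) (ρ : M → PEv → ℕ → M)
    (hren : ∀ G e h, Φ (Gen.renew G e h) = ρ (Φ G) e h)
    (A : ℕ → ℕ → Multiset M → M)
    (hchain : ∀ (s : ℕ) (q₀ : Gen PEv) (qs : List (Gen PEv)), clusterParts PEv.step s q₀ = [([], q₀)] →
      (∀ q ∈ qs, clusterParts PEv.step s q = [([], q)]) → (∀ q ∈ qs, q₀.rootStep ≤ q.rootStep) →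
        Φ (chainMerge q₀ qs (merL s)) =
          A s (chainMerge q₀ qs (merL s)).rootStep (((q₀ :: qs).map Φ : List M) : Multiset M))
    (hH : ∀ c, P.HeadOldest c) (c : α) : Φ (P.sortR.gen c) = Φ (P.gen c) := by
  have hpart : ∀ q ∈ P.parts c, Φ (P.sortR.flatPart c q) = Φ (P.flatPart c q) := by
    intro q hq
    rcases q with ⟨c', _ | _⟩ | ⟨d, x⟩
    · have hlt := P.step_lt c c' false hq
      exact letter_gen_sortR Φ ρ hren A hchain hH c'
    · have hlt := P.step_lt c c' true hq
      simp only [Pedigree.flatPart, Pedigree.step_sortR, hren]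
      rw [letter_gen_sortR Φ ρ hren A hchain hH c']
    · rfl
  cases hps : P.parts c with
  | nil => rw [gen_eq_of_nil P hps, gen_eq_of_nil P.sortR (P.parts_sortR_of_nil hps)]; rfl
  | cons p ps =>
      have hPS := P.parts_sortR_of_cons hps
      set ps' := ps.mergeSort fun q q' => decide (P.keyR c q ≤ P.keyR c q') with hps'
      have hperm : ps'.Perm ps := List.mergeSort_perm ps _
      have hrt : (P.sortR.gen c).rootStep = (P.gen c).rootStep := rootStep_gen_sortR P hH c
      rw [gen_eq_of_cons P hps, gen_eq_of_cons P.sortR hPS] at hrt ⊢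
      simp only [Pedigree.step_sortR] at hrt ⊢
      have hp : p ∈ P.parts c := by rw [hps]; exact List.mem_cons_self
      have hsub' : ∀ q ∈ ps', q ∈ P.parts c := fun q hq => by
        rw [hps]; exact List.mem_cons_of_mem _ (hperm.mem_iff.1 hq)
      rw [hchain (P.step c) _ _ (closed_flatPart P c p hp)
          (fun q hq => by
            obtain ⟨q', hq', rfl⟩ := List.mem_map.1 hq
            exact closed_flatPart P c q' (by rw [hps]; exact List.mem_cons_of_mem _ hq'))
          (fun q hq => by
            obtain ⟨q', hq', rfl⟩ := List.mem_map.1 hq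
            exact (P.headOldest_flat (hH c) hps).1 q' hq'),
        hchain (P.step c) _ _ (closed_flatPart P.sortR c p (by rw [hPS]; exact List.mem_cons_self))
          (fun q hq => by
            obtain ⟨q', hq', rfl⟩ := List.mem_map.1 hq
            exact closed_flatPart P.sortR c q' (by rw [hPS]; exact List.mem_cons_of_mem _ hq'))
          (fun q hq => by
            obtain ⟨q', hq', rfl⟩ := List.mem_map.1 hq
            rw [rootStep_flatPart_sortR P hH, rootStep_flatPart_sortR P hH]
            exact (P.headOldest_flat (hH c) hps).1 q' (hperm.mem_iff.1 hq')),
        hrt]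
      congr 1
      simp only [List.map_cons, List.map_map]
      rw [hpart p hp, show (Φ ∘ P.sortR.flatPart c) = fun q => Φ (P.sortR.flatPart c q) from rfl,
        List.map_congr_left fun q hq => hpart q (hsub' q hq)]
      exact Multiset.cons_eq_cons.2 (Or.inl ⟨rfl, Multiset.coe_eq_coe.2 (hperm.map _)⟩)
termination_by P.step c
decreasing_by all_goals exact hlt

/-- **BIRTH MASS IS UNCHANGED** by sorting the tails. [folklore] -/
theorem bsum_gen_sortR (w : PEv → ℝ) (hH : ∀ c, P.HeadOldest c) (c : α) : bsum w (P.sortR.gen c) = bsum w (P.gen c) :=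
  letter_gen_sortR P (bsum w) (fun m _ _ => m) (fun _ _ _ => rfl) (fun _ _ m => m.sum)
    (fun s q₀ qs _ _ _ => by rw [bsum_chainMerge]; simp) hH c

/-- **THE RENEWAL COUNT IS UNCHANGED** by sorting the tails. [folklore] -/
theorem NR_gen_sortR (hH : ∀ c, P.HeadOldest c) (c : α) : NR PEv.step (P.sortR.gen c) = NR PEv.step (P.gen c) :=
  letter_gen_sortR P (NR PEv.step) (fun m _ _ => m + 1) (fun G e h => by rw [NR]) (fun _ _ m => m.sum)
    (fun s q₀ qs h₀ hqs _ => by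
      rw [show merL s = (fun _ => ((s, 2, 0) : PEv)) from rfl,
        NR_chain PEv.step (s := s) (l := ((s, 2, 0) : PEv)) rfl q₀ qs h₀ hqs]
      simp) hH c

/-- **THE MERGER COUNT IS UNCHANGED** by sorting the tails. [folklore] -/
theorem mrg_gen_sortR (hH : ∀ c, P.HeadOldest c) (c : α) : mrg PEv.step (P.sortR.gen c) = mrg PEv.step (P.gen c) :=
  letter_gen_sortR P (mrg PEv.step) (fun m _ _ => m) (fun G e h => by rw [mrg])
    (fun _ _ m => ((Multiset.card m - 1 : ℕ) : ℝ) + m.sum)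
    (fun s q₀ qs h₀ hqs _ => by
      rw [show merL s = (fun _ => ((s, 2, 0) : PEv)) from rfl,
        mrg_chain PEv.step (s := s) (l := ((s, 2, 0) : PEv)) rfl q₀ qs h₀ hqs]
      simp) hH c

/-- **PARTNER AGES ARE UNCHANGED** by sorting the tails. [folklore] -/
theorem partnerAges_gen_sortR (hH : ∀ c, P.HeadOldest c) (c : α) :
    partnerAges PEv.step (P.sortR.gen c) = partnerAges PEv.step (P.gen c) := by
  have h := letter_gen_sortR P (fun G => (partnerAges PEv.step G, G.rootStep))
    (fun m _ _ => m) (fun G e h => rfl)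
    (fun s r m => ((m.map fun x : ℕ × ℕ => x.1 + (s + 1 - x.2)).sum - (s + 1 - r), r))
    (fun s q₀ qs h₀ hqs _ => by
      have hc := partnerAges_chain PEv.step (s := s) (l := ((s, 2, 0) : PEv)) rfl q₀ qs h₀ hqs
      rw [show (fun _ : ℕ => ((s, 2, 0) : PEv)) = merL s from rfl] at hc
      refine Prod.ext ?_ rfl
      simp only [Multiset.map_coe, List.map_map, Multiset.sum_coe]
      rw [show ((fun x : ℕ × ℕ => x.1 + (s + 1 - x.2)) ∘ fun G => (partnerAges PEv.step G, G.rootStep)) =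
          fun q => partnerAges PEv.step q + (s + 1 - q.rootStep) from rfl, ← hc]
      omega) hH c
  exact congrArg Prod.fst h

/-! ## §3 Ancestries and the forest -/

/-- ancestries are unchanged [folklore] -/
theorem names_sortR (c : α) : P.sortR.names c = P.names c := by
  ext a
  rw [Pedigree.mem_names_iff, Pedigree.mem_names_iff]
  refine or_congr Iff.rfl ⟨?_, ?_⟩
  · rintro ⟨c', r, hm, ha⟩
    have hm' : Part.old c' r ∈ P.parts c := P.mem_parts_sortR.1 hm
    have hlt := P.step_lt c c' r hm'
    exact ⟨c', r, hm', by rwa [names_sortR c'] at ha⟩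
  · rintro ⟨c', r, hm, ha⟩
    have hlt := P.step_lt c c' r hm
    exact ⟨c', r, P.mem_parts_sortR.2 hm, by rwa [names_sortR c']⟩
termination_by P.step c
decreasing_by all_goals exact hlt

/-- **THE SORTED TWIN IS A FOREST** where the pedigree is. [folklore] -/
theorem forest_sortR {c : α} (hF : P.Forest c) : P.sortR.Forest c := by
  unfold Pedigree.Forest at hF ⊢
  have hsymm : ∀ {p q : Part α π},
      (∀ c₁ r₁ c₂ r₂, p = Part.old c₁ r₁ → q = Part.old c₂ r₂ → Disjoint (P.sortR.names c₁) (P.sortR.names c₂)) →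
        ∀ c₁ r₁ c₂ r₂, q = Part.old c₁ r₁ → p = Part.old c₂ r₂ → Disjoint (P.sortR.names c₁) (P.sortR.names c₂) :=
    fun h c₁ r₁ c₂ r₂ hq hp => (h c₂ r₂ c₁ r₁ hp hq).symm
  refine ((P.parts_sortR_perm c).pairwise_iff @hsymm).2 ?_
  refine hF.imp fun {p q} h => ?_
  intro c₁ r₁ c₂ r₂ hp hq
  rw [names_sortR, names_sortR]
  exact h c₁ r₁ c₂ r₂ hp hq

/-! ## §4 The END with the realised pedigree's letters -/

/-- **THE END FOR THE SORTED TWIN, RIGHT-HAND SIDE IN THE REALISED PEDIGREE'S LETTERS.** [folklore] -/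
theorem ENT_sortR_le [DecidableEq α] [DecidableEq π] (hH : ∀ c, P.HeadOldest c) (hR : P.RenewDated) (c : α) :
    ENT PEv.step (P.sortR.gen c) ≤
      2 * bsum (fun b => (1 : ℝ) + PEv.fat b) (P.gen c) + 4 * (partnerAges PEv.step (P.gen c) : ℝ) +
        8 * mrg PEv.step (P.gen c) + 8 * (NR PEv.step (P.gen c) : ℝ) := by
  have h := ENT_leR_sortR P hH hR c
  rwa [bsum_gen_sortR P _ hH, partnerAges_gen_sortR P hH, mrg_gen_sortR P hH, NR_gen_sortR P hH] at h


/-! ## §5 The counted member is a function of the recorded shape (appended v1.1) -/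

/-- the sorted twin's members are canonically written [folklore] -/
theorem canon_gen_sortR (hH : ∀ c, P.HeadOldest c) (hR : P.RenewDated) (c : α) : Canon (P.sortR.gen c) :=
  canon_gen P.sortR (headOldest_sortR P hH) (tailSortedR_sortR P hH) (renewDated_sortR P hR) c

/-- **THE COUNTED MEMBER IS A FUNCTION OF THE RECORDED SHAPE**: two realised pedigrees (possibly of different terms,
with different geometric part orders) whose components have the same recorded shape have the SAME sorted-twin member
— the injectivity «history ↦ (member, placement)» of the zone-form count needs exactly this. [folklore] -/
theorem sortR_gen_eq_iff {α' π' : Type*} (P' : Pedigree α' π') (hH : ∀ c, P.HeadOldest c) (hR : P.RenewDated)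
    (hH' : ∀ c, P'.HeadOldest c) (hR' : P'.RenewDated) (c : α) (c' : α') :
    P.sortR.gen c = P'.sortR.gen c' ↔ toShapeR PEv.step PEv.fat (P.gen c) = toShapeR PEv.step PEv.fat (P'.gen c') := by
  rw [← toShapeR_gen_sortR P hH c, ← toShapeR_gen_sortR P' hH' c']
  exact ⟨fun h => by rw [h], eq_of_toShapeR_eq (canon_gen_sortR P hH hR c) (canon_gen_sortR P' hH' hR' c')⟩

end Summit.QuantumFields.BalabanUV.T4Continuum.HistorySiblingEntropyBridge

end
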